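import Summits.QuantumFields.YangMills.Theses.FradkinShenkerFlow

/-!
# Stub `stub_twoBlockFactorization` of the line `maxcorr-halving` (crux `SusceptibilityToPoincare`)

Route `FradkinShenkerFlow` of `YangMills`, crux item `stmt-QuantumFields-9441`
(`Summit.QuantumFields.YangMills.Theses.FradkinShenkerFlow.SusceptibilityToPoincare`, FS ⇒ UP).
This file proves stub (C1) of the registered skeleton `Cruxes/SusceptibilityToPoincare/Lines/maxcorr-halving.lean`:
the **sharp two-block factorisation of the conditional variance**, the engine of Martinelli's
L²-bisection. It is a pure Hilbert-space fact, valid for EVERY probability measure `μ` on the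
configurations `GaugeConfig 4 (2S+1) G = (Edge → G)` of an arbitrary measurable space `G`.

Write `P_D := μ[· | cylinderEvents D]` (orthogonal projection in `L²(μ)` onto the
`𝓕_D`-measurable functions). For link sets `K ⊆ D₁`, `K ⊆ D₂` and `0 ≤ ρ < 1` with the ONE-SIDED
operator bound `‖P_{D₁}P_{D₂}h − P_K h‖₂ ≤ ρ‖h − P_K h‖₂` for all bounded measurable `h`, every bounded
measurable `F` satisfies

  `‖F − P_K F‖₂² ≤ (1 − ρ)⁻² (‖F − P_{D₁}F‖₂² + ‖F − P_{D₂}F‖₂²)`.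

## Proof

Everything is an integrated `L²(μ)` statement about the sub-σ-algebras `m_K ≤ m₁, m₂ ≤ m₀`
(`TwoBlock.integral_sq_le`, abstract probability space). Put `g := F − P_K F` (so `P_K g = 0`,
`g − P_i g = F − P_i F` a.e. by the tower property), `u := P₁ g`, `v := P₂ g`,
`t² := ∫ g²`, `x² := ∫ u²`, `y² := ∫ v²`, `aᵢ² := ∫ (F − P_i F)²`.
* Pythagoras (`TwoBlock.integral_sub_condExp_sq`, from the pull-out property
  `∫ (P f) w = ∫ f w` for `m`-measurable `w`, `TwoBlock.integral_condExp_mul`):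
  `t² = a₁² + x² = a₂² + y²`; in particular `y ≤ t`.
* `x² = ∫ u g = ∫ u (g − v) + ∫ u v ≤ x a₂ + ∫ (P₁ v) u ≤ x a₂ + x ‖P₁ v‖₂` (Cauchy–Schwarz,
  `TwoBlock.integral_mul_le_sqrt_mul_sqrt`, and the pull-out property again), and
  `‖P₁ v‖₂ ≤ ρ y` by the HYPOTHESIS applied to a pointwise-bounded measurable version of `v`
  (`TwoBlock.exists_bounded_version`; `P₂ v = v`, `P_K v = P_K g = 0` a.e.). Hence `x ≤ a₂ + ρ t`.
* Real arithmetic (`TwoBlock.real_core`): `t² = a₁² + x²`, `0 ≤ x ≤ a₂ + ρ t`, `0 ≤ ρ < 1` give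
  `t² ≤ (s + ρ t)²` with `s² = a₁² + a₂²`, so `(1 − ρ) t ≤ s`.
No adjoint/density argument and no group structure on `G` is used.
-/

noncomputable section

open MeasureTheory ProbabilityTheory
open Literature.MathematicalPhysics.QuantumFieldTheory

namespace Summit.QuantumFields.YangMills.Theorems.SusceptibilityToPoincare

namespace TwoBlock

/-! ### Real arithmetic core -/

/-- The elementary inequality behind the two-block factorisation: if `t² = a₁ + x²`,
`x² ≤ (√a₂ + √p) x`, `p ≤ ρ² y²`, `y² ≤ t²` and `0 ≤ ρ < 1`, then `(1 − ρ)² t² ≤ a₁ + a₂`. [folklore] -/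
theorem real_core {t2 a1 a2 x2 y2 p2 ρ : ℝ} (hρ0 : 0 ≤ ρ) (hρ1 : ρ < 1)
    (ha1 : 0 ≤ a1) (ha2 : 0 ≤ a2) (hx2 : 0 ≤ x2)
    (h1 : t2 = a1 + x2) (h2 : y2 ≤ t2)
    (hx : x2 ≤ Real.sqrt a2 * Real.sqrt x2 + Real.sqrt p2 * Real.sqrt x2)
    (hp : p2 ≤ ρ ^ 2 * y2) :
    t2 ≤ 1 / (1 - ρ) ^ 2 * (a1 + a2) := by
  have ht2 : 0 ≤ t2 := by rw [h1]; positivity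
  set x := Real.sqrt x2 with hx_def
  set a := Real.sqrt a2 with ha_def
  set p := Real.sqrt p2 with hp_def
  set t := Real.sqrt t2 with ht_def
  set s := Real.sqrt (a1 + a2) with hs_def
  have hx0 : 0 ≤ x := Real.sqrt_nonneg _
  have ha0 : 0 ≤ a := Real.sqrt_nonneg _
  have hp0 : 0 ≤ p := Real.sqrt_nonneg _
  have ht0 : 0 ≤ t := Real.sqrt_nonneg _
  have hs0 : 0 ≤ s := Real.sqrt_nonneg _
  have hxx : x ^ 2 = x2 := Real.sq_sqrt hx2
  have haa : a ^ 2 = a2 := Real.sq_sqrt ha2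
  have htt : t ^ 2 = t2 := Real.sq_sqrt ht2
  have hss : s ^ 2 = a1 + a2 := Real.sq_sqrt (by positivity)
  -- `p ≤ ρ t`
  have hpt : p ≤ ρ * t := by
    calc p ≤ Real.sqrt (ρ ^ 2 * t2) :=
          Real.sqrt_le_sqrt (hp.trans (mul_le_mul_of_nonneg_left h2 (sq_nonneg ρ)))
      _ = ρ * t := by rw [Real.sqrt_mul (sq_nonneg ρ), Real.sqrt_sq hρ0]
  -- `x ≤ a + p`
  have hxap : x ≤ a + p := by
    by_contra hle
    have hlt : a + p < x := not_le.1 hle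
    have hxpos : 0 < x := lt_of_le_of_lt (add_nonneg ha0 hp0) hlt
    have : (a + p) * x < x * x := mul_lt_mul_of_pos_right hlt hxpos
    nlinarith [hx, hxx]
  -- `a ≤ s`
  have has : a ≤ s := Real.sqrt_le_sqrt (by linarith)
  -- `t² ≤ (s + ρ t)²`
  have hxt : x ≤ a + ρ * t := hxap.trans (by linarith)
  have ht_sq : t ^ 2 ≤ (s + ρ * t) ^ 2 := by
    have hx_sq : x ^ 2 ≤ (a + ρ * t) ^ 2 := pow_le_pow_left₀ hx0 hxt 2
    have hρt : 0 ≤ ρ * t := mul_nonneg hρ0 ht0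
    nlinarith [hx_sq, has, hρt, htt, hxx, h1, hss, haa]
  have ht_le : t ≤ s + ρ * t := by
    by_contra hle
    have hlt : s + ρ * t < t := not_le.1 hle
    have h0 : 0 ≤ s + ρ * t := add_nonneg hs0 (mul_nonneg hρ0 ht0)
    nlinarith [mul_self_lt_mul_self h0 hlt]
  -- `(1 - ρ) t ≤ s`, square and divide
  have h1ρ : 0 < 1 - ρ := by linarith
  have hfin : ((1 - ρ) * t) ^ 2 ≤ s ^ 2 :=
    pow_le_pow_left₀ (mul_nonneg h1ρ.le ht0) (by linarith) 2
  rw [mul_pow, htt, hss] at hfin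
  rw [one_div, ← div_eq_inv_mul, le_div_iff₀ (pow_pos h1ρ 2)]
  linarith

/-! ### Abstract `L²` facts about conditional expectations -/

section L2

variable {Ω : Type*} {m m0 : MeasurableSpace Ω} {μ : Measure Ω}

/-- Cauchy–Schwarz in `L²(μ)` for real functions, in integral form:
`∫ f g ≤ √(∫ f²) √(∫ g²)`. [folklore] -/
theorem integral_mul_le_sqrt_mul_sqrt {f g : Ω → ℝ} (hf : MemLp f 2 μ) (hg : MemLp g 2 μ) :
    ∫ ω, f ω * g ω ∂μ ≤ Real.sqrt (∫ ω, f ω ^ 2 ∂μ) * Real.sqrt (∫ ω, g ω ^ 2 ∂μ) := by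
  have h1 : ∫ ω, f ω * g ω ∂μ ≤ ∫ ω, ‖f ω‖ * ‖g ω‖ ∂μ := by
    calc ∫ ω, f ω * g ω ∂μ ≤ ‖∫ ω, f ω * g ω ∂μ‖ := Real.le_norm_self _
      _ ≤ ∫ ω, ‖f ω * g ω‖ ∂μ := norm_integral_le_integral_norm _
      _ = ∫ ω, ‖f ω‖ * ‖g ω‖ ∂μ := by simp_rw [norm_mul]
  have hf' : MemLp f (ENNReal.ofReal 2) μ := by simpa using hf
  have hg' : MemLp g (ENNReal.ofReal 2) μ := by simpa using hg
  have h2 := integral_mul_norm_le_Lp_mul_Lq Real.HolderConjugate.two_two hf' hg'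
  refine h1.trans (h2.trans_eq ?_)
  simp_rw [Real.rpow_two, Real.norm_eq_abs, sq_abs, Real.sqrt_eq_rpow]

/-- Products of two `L²` functions are integrable. [folklore] -/
theorem integrable_mul_of_memLp {f g : Ω → ℝ} (hf : MemLp f 2 μ) (hg : MemLp g 2 μ) :
    Integrable (fun ω => f ω * g ω) μ :=
  hf.integrable_mul hg

/-- A measurable, a.e.-bounded real function has a pointwise-bounded measurable version
(truncation `max (-C) (min C ·)`). [folklore] -/
theorem exists_bounded_version {g : Ω → ℝ} (hg : Measurable[m0] g) {C : ℝ} (hC0 : 0 ≤ C)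
    (hC : ∀ᵐ ω ∂μ, |g ω| ≤ C) :
    ∃ h : Ω → ℝ, Measurable[m0] h ∧ (∀ ω, |h ω| ≤ C) ∧ h =ᵐ[μ] g := by
  refine ⟨fun ω => max (-C) (min C (g ω)), measurable_const.max (measurable_const.min hg),
    fun ω => abs_le.2 ⟨le_max_left _ _, max_le (by linarith) (min_le_left _ _)⟩, ?_⟩
  filter_upwards [hC] with ω hω
  obtain ⟨hl, hr⟩ := abs_le.1 hω
  rw [min_eq_right hr, max_eq_right hl]

variable [IsFiniteMeasure μ]

/-- Pull-out / self-adjointness of the conditional expectation in `L²`: for `m`-measurable `w`,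
`∫ μ[f|m] w dμ = ∫ f w dμ`. [folklore] -/
theorem integral_condExp_mul (hm : m ≤ m0) {f w : Ω → ℝ} (hf : MemLp f 2 μ) (hw : MemLp w 2 μ)
    (hwm : StronglyMeasurable[m] w) :
    ∫ ω, μ[f|m] ω * w ω ∂μ = ∫ ω, f ω * w ω ∂μ := by
  have hfw : Integrable (f * w) μ := hf.integrable_mul hw
  have h := condExp_mul_of_stronglyMeasurable_right hwm hfw (hf.integrable one_le_two)
  calc ∫ ω, μ[f|m] ω * w ω ∂μ = ∫ ω, (μ[f * w|m]) ω ∂μ := by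
        refine integral_congr_ae ?_
        filter_upwards [h] with ω hω
        rw [hω, Pi.mul_apply]
    _ = ∫ ω, (f * w) ω ∂μ := integral_condExp hm
    _ = ∫ ω, f ω * w ω ∂μ := rfl

/-- Pythagoras for the orthogonal projection `μ[·|m]`:
`∫ (f − μ[f|m])² = ∫ f² − ∫ (μ[f|m])²`. [folklore] -/
theorem integral_sub_condExp_sq (hm : m ≤ m0) {f : Ω → ℝ} (hf : MemLp f 2 μ) :
    ∫ ω, (f ω - μ[f|m] ω) ^ 2 ∂μ = ∫ ω, f ω ^ 2 ∂μ - ∫ ω, (μ[f|m] ω) ^ 2 ∂μ := by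
  have hc : MemLp (μ[f|m]) 2 μ := hf.condExp one_le_two
  have key : ∫ ω, μ[f|m] ω * μ[f|m] ω ∂μ = ∫ ω, f ω * μ[f|m] ω ∂μ :=
    integral_condExp_mul hm hf hc stronglyMeasurable_condExp
  have e : ∀ ω, (f ω - μ[f|m] ω) ^ 2 = (f ω ^ 2 + (μ[f|m] ω) ^ 2) - 2 * (f ω * μ[f|m] ω) :=
    fun ω => by ring
  have i1 : Integrable (fun ω => f ω ^ 2 + (μ[f|m] ω) ^ 2) μ := hf.integrable_sq.add hc.integrable_sq
  have i2 : Integrable (fun ω => 2 * (f ω * μ[f|m] ω)) μ :=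
    (integrable_mul_of_memLp hf hc).const_mul 2
  have e3 : ∫ ω, μ[f|m] ω * μ[f|m] ω ∂μ = ∫ ω, (μ[f|m] ω) ^ 2 ∂μ := by simp_rw [sq]
  simp_rw [e]
  rw [integral_sub i1 i2, integral_add hf.integrable_sq hc.integrable_sq, integral_const_mul, ← key, e3]
  ring

end L2

/-! ### The two-block inequality on an abstract probability space -/

section Core

variable {Ω : Type*} {m0 : MeasurableSpace Ω} {μ : Measure Ω} [IsProbabilityMeasure μ]
  {mK m1 m2 : MeasurableSpace Ω}

/-- Core of the two-block factorisation, for a function `g ∈ L²(μ)` that is a.e. bounded and has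
`μ[g|m_K] = 0` a.e.: if `‖P₁P₂h − P_K h‖₂ ≤ ρ‖h − P_K h‖₂` for all bounded measurable `h`
(`P_D := μ[·|m_D]`, `m_K ≤ m₂`), then `∫ g² ≤ (1 − ρ)⁻² (∫ (g − P₁ g)² + ∫ (g − P₂ g)²)`. [folklore] -/
theorem integral_sq_le_of_condExp_eq_zero (hK2 : mK ≤ m2) (h1 : m1 ≤ m0) (h2 : m2 ≤ m0)
    {ρ : ℝ} (hρ0 : 0 ≤ ρ) (hρ1 : ρ < 1)
    (hyp : ∀ h : Ω → ℝ, Measurable[m0] h → (∃ M : ℝ, ∀ ω, |h ω| ≤ M) →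
        ∫ ω, (μ[μ[h|m2]|m1] ω - μ[h|mK] ω) ^ 2 ∂μ ≤ ρ ^ 2 * ∫ ω, (h ω - μ[h|mK] ω) ^ 2 ∂μ)
    {g : Ω → ℝ} (hg : MemLp g 2 μ) {C : ℝ} (hgC : ∀ᵐ ω ∂μ, |g ω| ≤ C)
    (hKg : μ[g|mK] =ᵐ[μ] 0) :
    ∫ ω, g ω ^ 2 ∂μ ≤
      1 / (1 - ρ) ^ 2 * ((∫ ω, (g ω - μ[g|m1] ω) ^ 2 ∂μ) + ∫ ω, (g ω - μ[g|m2] ω) ^ 2 ∂μ) := by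
  have hum : MemLp (μ[g|m1]) 2 μ := hg.condExp one_le_two
  have hvm : MemLp (μ[g|m2]) 2 μ := hg.condExp one_le_two
  have hPv : MemLp (μ[μ[g|m2]|m1]) 2 μ := hvm.condExp one_le_two
  have hgv : MemLp (fun ω => g ω - μ[g|m2] ω) 2 μ := hg.sub hvm
  -- Pythagoras
  have pyth1 : ∫ ω, (g ω - μ[g|m1] ω) ^ 2 ∂μ = ∫ ω, g ω ^ 2 ∂μ - ∫ ω, (μ[g|m1] ω) ^ 2 ∂μ :=
    integral_sub_condExp_sq h1 hg
  have pyth2 : ∫ ω, (g ω - μ[g|m2] ω) ^ 2 ∂μ = ∫ ω, g ω ^ 2 ∂μ - ∫ ω, (μ[g|m2] ω) ^ 2 ∂μ :=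
    integral_sub_condExp_sq h2 hg
  -- `x² = ∫ (g - v) u + ∫ (P₁ v) u` with `u := P₁ g`, `v := P₂ g`
  have hx2 : ∫ ω, (μ[g|m1] ω) ^ 2 ∂μ =
      ∫ ω, (g ω - μ[g|m2] ω) * μ[g|m1] ω ∂μ + ∫ ω, μ[μ[g|m2]|m1] ω * μ[g|m1] ω ∂μ := by
    have e1 : ∫ ω, μ[g|m1] ω * μ[g|m1] ω ∂μ = ∫ ω, g ω * μ[g|m1] ω ∂μ :=
      integral_condExp_mul h1 hg hum stronglyMeasurable_condExp
    have e2 : ∫ ω, μ[μ[g|m2]|m1] ω * μ[g|m1] ω ∂μ = ∫ ω, μ[g|m2] ω * μ[g|m1] ω ∂μ :=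
      integral_condExp_mul h1 hvm hum stronglyMeasurable_condExp
    have e3 : ∫ ω, (μ[g|m1] ω) ^ 2 ∂μ = ∫ ω, μ[g|m1] ω * μ[g|m1] ω ∂μ := by simp_rw [sq]
    rw [e3, e1, e2, ← integral_add (integrable_mul_of_memLp hgv hum) (integrable_mul_of_memLp hvm hum)]
    refine integral_congr_ae (ae_of_all _ fun ω => ?_)
    ring
  -- Cauchy–Schwarz
  have cs1 : ∫ ω, (g ω - μ[g|m2] ω) * μ[g|m1] ω ∂μ ≤
      Real.sqrt (∫ ω, (g ω - μ[g|m2] ω) ^ 2 ∂μ) * Real.sqrt (∫ ω, (μ[g|m1] ω) ^ 2 ∂μ) :=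
    integral_mul_le_sqrt_mul_sqrt hgv hum
  have cs2 : ∫ ω, μ[μ[g|m2]|m1] ω * μ[g|m1] ω ∂μ ≤
      Real.sqrt (∫ ω, (μ[μ[g|m2]|m1] ω) ^ 2 ∂μ) * Real.sqrt (∫ ω, (μ[g|m1] ω) ^ 2 ∂μ) :=
    integral_mul_le_sqrt_mul_sqrt hPv hum
  -- the hypothesis applied to a bounded measurable version `w` of `v = P₂ g`
  have hPv_le : ∫ ω, (μ[μ[g|m2]|m1] ω) ^ 2 ∂μ ≤ ρ ^ 2 * ∫ ω, (μ[g|m2] ω) ^ 2 ∂μ := by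
    have hgC' : ∀ᵐ ω ∂μ, |g ω| ≤ max C 0 := hgC.mono fun ω hω => hω.trans (le_max_left _ _)
    have hvC : ∀ᵐ ω ∂μ, |μ[g|m2] ω| ≤ max C 0 := ae_bdd_abs_condExp_of_ae_bdd_abs hgC'
    have hv_meas : Measurable[m0] (μ[g|m2]) :=
      ((stronglyMeasurable_condExp (m := m2) (μ := μ) (f := g)).mono h2).measurable
    obtain ⟨w, hw_meas, hw_bdd, hw_ae⟩ :=
      exists_bounded_version (μ := μ) hv_meas (le_max_right C 0) hvC
    have H := hyp w hw_meas ⟨_, hw_bdd⟩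
    have hvv : μ[μ[g|m2]|m2] = μ[g|m2] :=
      condExp_of_stronglyMeasurable h2 stronglyMeasurable_condExp integrable_condExp
    have hw2 : μ[w|m2] =ᵐ[μ] μ[g|m2] := by
      have h := condExp_congr_ae (m := m2) (μ := μ) hw_ae
      rwa [hvv] at h
    have hw21 : μ[μ[w|m2]|m1] =ᵐ[μ] μ[μ[g|m2]|m1] := condExp_congr_ae hw2
    have hwK : μ[w|mK] =ᵐ[μ] 0 :=
      (condExp_congr_ae hw_ae).trans ((condExp_condExp_of_le hK2 h2).trans hKg)
    have lhs : ∫ ω, (μ[μ[w|m2]|m1] ω - μ[w|mK] ω) ^ 2 ∂μ = ∫ ω, (μ[μ[g|m2]|m1] ω) ^ 2 ∂μ := by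
      refine integral_congr_ae ?_
      filter_upwards [hw21, hwK] with ω h21 hK
      rw [h21, hK, Pi.zero_apply, sub_zero]
    have rhs : ∫ ω, (w ω - μ[w|mK] ω) ^ 2 ∂μ = ∫ ω, (μ[g|m2] ω) ^ 2 ∂μ := by
      refine integral_congr_ae ?_
      filter_upwards [hw_ae, hwK] with ω hωv hK
      rw [hωv, hK, Pi.zero_apply, sub_zero]
    rw [lhs, rhs] at H
    exact H
  -- assemble
  have ha1 : 0 ≤ ∫ ω, (g ω - μ[g|m1] ω) ^ 2 ∂μ := integral_nonneg fun ω => sq_nonneg _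
  have ha2 : 0 ≤ ∫ ω, (g ω - μ[g|m2] ω) ^ 2 ∂μ := integral_nonneg fun ω => sq_nonneg _
  have hx2' : 0 ≤ ∫ ω, (μ[g|m1] ω) ^ 2 ∂μ := integral_nonneg fun ω => sq_nonneg _
  exact real_core hρ0 hρ1 ha1 ha2 hx2' (by linarith) (by linarith)
    (by linarith [hx2, cs1, cs2]) hPv_le

/-- The two-block factorisation on an abstract probability space: sub-σ-algebras
`m_K ≤ m₁, m₂ ≤ m₀`, `0 ≤ ρ < 1`, the one-sided bound `‖P₁P₂h − P_K h‖₂ ≤ ρ‖h − P_K h‖₂` for all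
bounded measurable `h`; then `‖F − P_K F‖₂² ≤ (1 − ρ)⁻²(‖F − P₁F‖₂² + ‖F − P₂F‖₂²)` for all
bounded measurable `F`. [folklore] -/
theorem integral_sq_le (hK1 : mK ≤ m1) (hK2 : mK ≤ m2) (h1 : m1 ≤ m0) (h2 : m2 ≤ m0)
    {ρ : ℝ} (hρ0 : 0 ≤ ρ) (hρ1 : ρ < 1)
    (hyp : ∀ h : Ω → ℝ, Measurable[m0] h → (∃ M : ℝ, ∀ ω, |h ω| ≤ M) →
        ∫ ω, (μ[μ[h|m2]|m1] ω - μ[h|mK] ω) ^ 2 ∂μ ≤ ρ ^ 2 * ∫ ω, (h ω - μ[h|mK] ω) ^ 2 ∂μ)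
    {F : Ω → ℝ} (hF : Measurable[m0] F) (hFb : ∃ M : ℝ, ∀ ω, |F ω| ≤ M) :
    ∫ ω, (F ω - μ[F|mK] ω) ^ 2 ∂μ ≤
      1 / (1 - ρ) ^ 2 * ((∫ ω, (F ω - μ[F|m1] ω) ^ 2 ∂μ) + ∫ ω, (F ω - μ[F|m2] ω) ^ 2 ∂μ) := by
  obtain ⟨M, hM⟩ := hFb
  have hK : mK ≤ m0 := hK1.trans h1
  have hFm : MemLp F 2 μ := MemLp.of_bound hF.aestronglyMeasurable M
    (ae_of_all μ fun ω => by simpa only [Real.norm_eq_abs] using hM ω)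
  have hFi : Integrable F μ := hFm.integrable one_le_two
  have hgm : MemLp (F - μ[F|mK]) 2 μ := hFm.sub (hFm.condExp one_le_two)
  -- a.e. bound on `g := F - μ[F|mK]`
  have hKF : ∀ᵐ ω ∂μ, |μ[F|mK] ω| ≤ M := ae_bdd_abs_condExp_of_ae_bdd_abs (ae_of_all μ hM)
  have hgC : ∀ᵐ ω ∂μ, |(F - μ[F|mK]) ω| ≤ M + M := by
    filter_upwards [hKF] with ω hω
    rw [Pi.sub_apply]
    exact (abs_sub _ _).trans (add_le_add (hM ω) hω)
  -- `P_K g = 0`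
  have hKg : μ[F - μ[F|mK] | mK] =ᵐ[μ] 0 := by
    filter_upwards [condExp_sub hFi integrable_condExp mK] with ω hω
    rw [hω, Pi.sub_apply, Pi.zero_apply,
      condExp_of_stronglyMeasurable hK stronglyMeasurable_condExp integrable_condExp, sub_self]
  -- `g - P_i g = F - P_i F`
  have hgi : ∀ {m' : MeasurableSpace Ω}, mK ≤ m' → m' ≤ m0 →
      (fun ω => ((F - μ[F|mK]) ω - μ[F - μ[F|mK] | m'] ω) ^ 2) =ᵐ[μ]
        fun ω => (F ω - μ[F|m'] ω) ^ 2 := by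
    intro m' hKm' hm'
    have hfix : μ[μ[F|mK]|m'] = μ[F|mK] :=
      condExp_of_stronglyMeasurable hm' (stronglyMeasurable_condExp.mono hKm') integrable_condExp
    filter_upwards [condExp_sub hFi integrable_condExp m'] with ω hω
    rw [hω, Pi.sub_apply, Pi.sub_apply, hfix]
    ring
  have key := integral_sq_le_of_condExp_eq_zero hK2 h1 h2 hρ0 hρ1 hyp hgm hgC hKg
  rw [integral_congr_ae (hgi hK1 h1), integral_congr_ae (hgi hK2 h2)] at key
  simpa only [Pi.sub_apply] using key

end Core

end TwoBlock

/-! ### The registered stub -/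

/-- `stub_twoBlockFactorization` — **sharp two-block factorisation of the conditional variance**
(stub C1 of the line `maxcorr-halving`). For EVERY probability measure `μ` on the configurations
`GaugeConfig 4 (2S+1) G` (`G` any measurable space), link sets `K ⊆ D₁`, `K ⊆ D₂`, `0 ≤ ρ < 1` with
`‖P_{D₁}P_{D₂}h − P_K h‖₂ ≤ ρ‖h − P_K h‖₂` for all bounded measurable `h`
(`P_D = E_μ[·|cylinderEvents D]`): for all bounded measurable `F`,
`‖F − P_K F‖₂² ≤ (1−ρ)⁻² (‖F − P_{D₁}F‖₂² + ‖F − P_{D₂}F‖₂²)`. Instance of the abstract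
`TwoBlock.integral_sq_le` with `cylinderEvents_mono`, `cylinderEvents_le_pi`. [folklore] -/
theorem stub_twoBlockFactorization :
    ∀ (G : Type) [MeasurableSpace G] (S : ℕ) (μ : Measure (GaugeConfig 4 (2 * S + 1) G)) [IsProbabilityMeasure μ]
      (K D₁ D₂ : Set (Edge 4 (2 * S + 1))), K ⊆ D₁ → K ⊆ D₂ → ∀ ρ : ℝ, 0 ≤ ρ → ρ < 1 →
      (∀ h : GaugeConfig 4 (2 * S + 1) G → ℝ, Measurable h → (∃ M : ℝ, ∀ U, |h U| ≤ M) →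
        ∫ U, (condExp (cylinderEvents D₁) μ (condExp (cylinderEvents D₂) μ h) U
            - condExp (cylinderEvents K) μ h U) ^ 2 ∂μ ≤
          ρ ^ 2 * ∫ U, (h U - condExp (cylinderEvents K) μ h U) ^ 2 ∂μ) →
      ∀ F : GaugeConfig 4 (2 * S + 1) G → ℝ, Measurable F → (∃ M : ℝ, ∀ U, |F U| ≤ M) →
      ∫ U, (F U - condExp (cylinderEvents K) μ F U) ^ 2 ∂μ ≤
        (1 / (1 - ρ) ^ 2) * ((∫ U, (F U - condExp (cylinderEvents D₁) μ F U) ^ 2 ∂μ) +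
          ∫ U, (F U - condExp (cylinderEvents D₂) μ F U) ^ 2 ∂μ) := by
  intro G _ S μ _ K D₁ D₂ hK1 hK2 ρ hρ0 hρ1 hyp F hF hFb
  exact TwoBlock.integral_sq_le (cylinderEvents_mono hK1) (cylinderEvents_mono hK2)
    cylinderEvents_le_pi cylinderEvents_le_pi hρ0 hρ1 hyp hF hFb

end Summit.QuantumFields.YangMills.Theorems.SusceptibilityToPoincare

end
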